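import Summits.QuantumFields.YangMills.Theorems.BalabanUVNodesN13Cor3Repr218LeavesAtRecord13CoPH
import Literature.Computability.AlgebraicComplexity.SlidingWindowNumerics

/-!
# BalabanUVNodes ∕ N13 — THE COMBINATORIAL LEAF OF [III] COR. 3 AT NODE 00's STAGE-13 RECORD, IN THE (0.2) [IV] CURRENCY: `ρ_k = Σ_Z ρ_k(Z,·)` FOR `densOfRecord₁₃`, THE COUNT OVER LAST
# LARGE-FIELD REGIONS PROVED, AND THE UPPER HALF OF (0.1) FROM ONE DISPLAYED PER-REGION ESTIMATE (Track A, DAG node N13 = [B16]; cluster K1 — K1⁷ `StabilityBAtRecordR13SepCoPH` =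
# stmt-QuantumFields-20542, helper; seat `pub-ymgap-dag-n13-w3` g2, successor pointer (S1) of g0's census (the leaf (U2) of p592785 ∕ p594664 ∕ p597689); 2026-08-28; count-neutral)

HONEST FRAMING.  Count-neutral kernel BOOKKEEPING + [folklore] finite combinatorics; nothing of Bałaban's is asserted.  [III] Cor. 3's printed proof (p. 264) is ONE sentence: *«we estimate
the integral ∫dV_k ρ_k by a sum of terms similar to the one considered in Sect. 3 [6], e.g., see (3.42) … the combinatorics now is the same, relative to the η-scale …, hence we have the same
result»*.  g0's files display it as adv3's leaves (U1) per-history majorant + (U2) «Σ_s major s ≤ exp(E₊|T₁^{(k)}|)» (GAPS G-adv3-1: the transfer of [6] (3.42) NOT carried out in print) + (L1)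
+ (L2).  THIS FILE PROVES THE COMBINATORIAL HALF in the currency of [IV] (0.2) *«ρ(V) = Σ_Z ρ(Z, V), where the sum is over large field regions Z»* (def-R's `pieceOfRecord` ∕ `sum_pieceOfRecord`,
hitherto without consumer): (i) [folklore] for ANY finite class `𝒟` of unions of cubes of a finite family `I` and `x ≥ 0`, `Σ_{S∈𝒟} x^{#cubes of I not inside S} ≤ (1+x)^{|I|} ≤ exp(x|I|)` —
each member is the union of the cubes it contains, so `S ↦ {cubes inside S}` injects `𝒟` into `𝒫(I)` and the binomial theorem counts ([6] (3.46)'s *«Σ over all the subsets»* in [III]'s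
letters); (ii) at the record's class `𝐃_k = DOfRecord = unionsOfCubes` the sum over last regions `Z` with `Zᶜ ∈ 𝐃_k` of `e^a·x^{#𝐃_k-cubes meeting Z}` is `≤ exp(a + x|I_k|)`, and `|I_k| ≤ |T₁^{(k)}|`
(`k ≤ K`); (iii) the pieces with `Zᶜ ∉ 𝐃_k` vanish; hence ★★★ the UPPER HALF of (0.1) at the record follows from the ONE displayed estimate (U1_Z) «`ρ_k(Z, V) ≤ e^{a₀|T₁^{(k)}|}·x^{#𝐃_k-cubes
meeting Z}`» with `a₀ + x ≤ E₊` — a [IV] (1.1) ∕ [V] (1.89)-type small factor per large-field cube of the LAST region, which is NOT proved here (it is Bałaban's 𝐑-operation bound).  Why the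
last-region currency and not full histories: `|I_j| ≈ L^{4(k−j)}|T₁^{(k)}|∕(M R_j)⁴`, so a per-history product count needs `x_j ≲ L^{−4(k−j)}` at early steps ([IV] p. 175's d = 4 sentence in
numbers; the full-history count is proved all the same in the sibling `…N13Cor3HistoryCountAtRecord13CoPH`), while the (0.2) count needs only `x·|I_k| ≤ x·|T₁^{(k)}|` at step `k`.
N13 NOT discharged; K0⁷ ∕ K1⁷ NOT closed; counts unmoved (discharged 5∕27 · Track A 5∕28).  ONE finite four-torus programme at fixed `ε = L^{−K}`; R4 closes the conditional finite-𝕋⁴ rung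
`BalabanLadder.UV` only — the Yang–Mills mass gap (Clay) is NOT proved by any of this; nothing continuum ∕ ℝ⁴ ∕ OS.  No `sorry`, `def`, `instance`, `notation`.

WHAT THIS FILE PROVES.
§1 [folklore]: `sum_powerset_pow_card_sub` (Σ_{B⊆I} x^{|I|−|B|} = (1+x)^{|I|}; `(1+x)^n ≤ e^{xn}` is the tree's `SlidingWindow.one_add_pow_le_exp`, reused), `ncard_not_subset_eq`, `eq_biUnion_inside_of_eq_biUnion`, ★ `injOn_inside`,
   ★ `classSum_pow_lf_le_add_pow` ∕ `classSum_pow_lf_le_exp`.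
§2 at def-R's objects: `pieceOfRecord_eq_zero_of_compl_not_mem`, ★★ `sum_lastRegionMajorant_le_exp` (the count at `𝐃_k` of record), `card_cubeIndices_dCubeSide_le_card_site` (`|I_k| ≤ |T₁^{(k)}|`).
§3 at the Stage-13 record: `densOfRecord₁₃_eq_sum_pieceOfRecord` ((0.2) for `densOfRecord₁₃`), `densOfRecord₁₃_le_of_U1Z_U2Z`, ★★★ `densOfRecord₁₃_le_of_pieceBound` ∕ `…_siteUnits` (upper half of
   (0.1) at every configuration from (U1_Z) + the numeric clause; (U2) PROVED).  The run family (`Cor3With` ∕ `Cor3_250` ∕ `EndStatementBPrinted` from Theorem 1 + (U1_Z) + (L1) + (L2)) and the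
   full-history currency are the sibling file `…N13Cor3HistoryCountAtRecord13CoPH` (imports this one).

Sources: [Balaban1988Convergent] (2.1)–(2.3) p.254–255, (2.17)–(2.18) p.257, Cor. 3 (2.50) + the sentence before it p.264; [Balaban1989LargeFieldI] (0.2) p.176, p.175; [Balaban1982Higgs2]
(3.42) p.592, (3.46) p.593 (cite only); [Balaban1989LargeFieldII] (0.1) pp.355–356.
-/

noncomputable section

open MeasureTheory
open scoped BigOperators

namespace Summit.QuantumFields.YangMills.BalabanUVNodes.N13Cor3LastRegionCountAtRecord13CoPH

open Literature.MathematicalPhysics.QuantumFieldTheory.Balaban1983to89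
open T4Continuum Node00 B14.Eq218Concrete
open Literature.Computability.AlgebraicComplexity.SlidingWindow (one_add_pow_le_exp)

/-! ## §1. Finite combinatorics [folklore]: binomial count over a class of unions of cubes -/

section Counting

variable {ι α : Type*}

/-- Binomial count: summing `x^{|I| − |B|}` over the subsets `B ⊆ I` gives `(1 + x)^{|I|}`. [folklore] -/
theorem sum_powerset_pow_card_sub (I : Finset ι) (x : ℝ) :
    ∑ B ∈ I.powerset, x ^ (I.card - B.card) = (1 + x) ^ I.card := by
  have h := Finset.sum_pow_mul_eq_add_pow (1 : ℝ) x I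
  simpa only [one_pow, one_mul] using h

/-- The number of cubes of the family `I` NOT inside `S` ("large-field cubes of `S`") is `|I|` minus the number of cubes inside `S`. [folklore] -/
theorem ncard_not_subset_eq (I : Finset ι) (cube : ι → Set α) (S : Set α) [DecidablePred fun c => cube c ⊆ S] :
    Set.ncard {c | c ∈ I ∧ ¬ cube c ⊆ S} = I.card - (I.filter (fun c => cube c ⊆ S)).card := by
  have h1 : ({c | c ∈ I ∧ ¬ cube c ⊆ S} : Set ι) = ↑(I.filter (fun c => ¬ cube c ⊆ S)) := by
    ext c; simp
  rw [h1, Set.ncard_coe_finset]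
  have h2 := Finset.card_filter_add_card_filter_not (s := I) (fun c => cube c ⊆ S)
  omega

/-- A union of cubes of the family IS the union of the family cubes it contains. [folklore] -/
theorem eq_biUnion_inside_of_eq_biUnion (I : Finset ι) (cube : ι → Set α) {S : Set α}
    {A : Finset ι} (hA : A ⊆ I) (hS : S = ⋃ a ∈ A, cube a) :
    S = ⋃ c ∈ {c | c ∈ I ∧ cube c ⊆ S}, cube c := by
  apply Set.Subset.antisymm
  · intro z hz
    have hz' := hz
    rw [hS] at hz'
    simp only [Set.mem_iUnion] at hz'
    obtain ⟨a, ha, hza⟩ := hz'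
    have hsub : cube a ⊆ S := by
      rw [hS]; exact Set.subset_biUnion_of_mem (u := fun a => cube a) ha
    simp only [Set.mem_iUnion, Set.mem_setOf_eq]
    exact ⟨a, ⟨hA ha, hsub⟩, hza⟩
  · intro z hz
    simp only [Set.mem_iUnion, Set.mem_setOf_eq] at hz
    obtain ⟨c, ⟨-, hc⟩, hzc⟩ := hz
    exact hc hzc

/-- On a class of unions of cubes, `S ↦ {cubes of I inside S}` is INJECTIVE (each member is recovered as the union of the cubes inside it). [folklore] -/
theorem injOn_inside (I : Finset ι) (cube : ι → Set α) (𝒟 : Set (Set α))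
    (h𝒟 : ∀ S ∈ 𝒟, ∃ A : Finset ι, A ⊆ I ∧ S = ⋃ a ∈ A, cube a) :
    Set.InjOn (fun S : Set α => {c | c ∈ I ∧ cube c ⊆ S}) 𝒟 := by
  intro S hS S' hS' h
  obtain ⟨A, hA, hSA⟩ := h𝒟 S hS
  obtain ⟨A', hA', hSA'⟩ := h𝒟 S' hS'
  have e1 := eq_biUnion_inside_of_eq_biUnion I cube hA hSA
  have e2 := eq_biUnion_inside_of_eq_biUnion I cube hA' hSA'
  have h' : {c | c ∈ I ∧ cube c ⊆ S} = {c | c ∈ I ∧ cube c ⊆ S'} := h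
  rw [e1, e2, h']

/-- **★ THE CLASS COUNT** ([6] (3.46)'s «Σ over all the subsets» in [III]'s letters): over ANY finite class `𝒟` of unions of cubes of a finite family `I`, with `x ≥ 0`,
`Σ_{S ∈ 𝒟} x^{#cubes of I not inside S} ≤ (1 + x)^{|I|}`. [folklore] -/
theorem classSum_pow_lf_le_add_pow (I : Finset ι) (cube : ι → Set α) (𝒟 : Finset (Set α))
    (h𝒟 : ∀ S ∈ 𝒟, ∃ A : Finset ι, A ⊆ I ∧ S = ⋃ a ∈ A, cube a) {x : ℝ} (hx : 0 ≤ x) :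
    ∑ S ∈ 𝒟, x ^ Set.ncard {c | c ∈ I ∧ ¬ cube c ⊆ S} ≤ (1 + x) ^ I.card := by
  classical
  have hinj : Set.InjOn (fun S : Set α => I.filter (fun c => cube c ⊆ S)) ↑𝒟 := by
    intro S hS S' hS' h
    have h' : ({c | c ∈ I ∧ cube c ⊆ S} : Set ι) = {c | c ∈ I ∧ cube c ⊆ S'} := by
      have := congrArg (fun B : Finset ι => (B : Set ι)) h
      simpa only [Finset.coe_filter] using this
    exact injOn_inside I cube ↑𝒟 (fun T hT => h𝒟 T hT) hS hS' h'
  calc ∑ S ∈ 𝒟, x ^ Set.ncard {c | c ∈ I ∧ ¬ cube c ⊆ S}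
      = ∑ S ∈ 𝒟, x ^ (I.card - (I.filter (fun c => cube c ⊆ S)).card) := by
        refine Finset.sum_congr rfl fun S _ => ?_
        rw [ncard_not_subset_eq]
    _ = ∑ B ∈ 𝒟.image (fun S : Set α => I.filter (fun c => cube c ⊆ S)), x ^ (I.card - B.card) :=
        (Finset.sum_image (f := fun B : Finset ι => x ^ (I.card - B.card)) hinj).symm
    _ ≤ ∑ B ∈ I.powerset, x ^ (I.card - B.card) := by
        apply Finset.sum_le_sum_of_subset_of_nonneg
        · intro B hB
          rw [Finset.mem_image] at hB
          obtain ⟨S, -, rfl⟩ := hB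
          exact Finset.mem_powerset.mpr (Finset.filter_subset _ _)
        · intro B _ _; positivity
    _ = (1 + x) ^ I.card := sum_powerset_pow_card_sub I x

/-- The class count in exponential form: `Σ_{S ∈ 𝒟} x^{#cubes not inside S} ≤ exp(x·|I|)`. [folklore] -/
theorem classSum_pow_lf_le_exp (I : Finset ι) (cube : ι → Set α) (𝒟 : Finset (Set α))
    (h𝒟 : ∀ S ∈ 𝒟, ∃ A : Finset ι, A ⊆ I ∧ S = ⋃ a ∈ A, cube a) {x : ℝ} (hx : 0 ≤ x) :
    ∑ S ∈ 𝒟, x ^ Set.ncard {c | c ∈ I ∧ ¬ cube c ⊆ S} ≤ Real.exp (x * I.card) :=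
  (classSum_pow_lf_le_add_pow I cube 𝒟 h𝒟 hx).trans (one_add_pow_le_exp hx _)

end Counting


/-! ## §2. The (0.2) [IV] regrouping of `densOfRecord₁₃` by LAST large-field region, and the count AT THE RECORD's class `𝐃_k` -/

section LastRegion

variable (F : T4Family) (N : ℕ) [NeZero N]

open Classical in
/-- **A PIECE VANISHES UNLESS ITS LAST REGION IS THE COMPLEMENT OF A `𝐃_k`-DOMAIN** (def-R's `pieceOfRecord`, any residual data `texpA`): `ρ_k(Z, ·) = 0` whenever `Zᶜ ∉ 𝐃_k`
of record — for `k ≥ 1` because `Z = Λ_k(s)ᶜ` with `Λ_k(s) ∈ 𝐃_k` ((2.1)), for `k = 0` because the only last region is `Z = ∅ᶜ` and `∅ ∈ 𝐃_0`. [cite: Balaban1989LargeFieldI, (0.2) p.176; Balaban1988Convergent, (2.1)–(2.3) p.254–255 (bookkeeping)] -/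
theorem pieceOfRecord_eq_zero_of_compl_not_mem (ν : Stage7Numerics) (M : ℕ) (texpA : TexpAOfRecord F N ν M) (p : B12.RunParams)
    (g : ℕ → ℝ) (k : ℕ) (Z : Set (Site (F.P p.K) 0)) (hZ : Zᶜ ∉ DOfRecord F ν M g p.K k) (V : GaugeField (F.P p.K) k (SU N)) :
    pieceOfRecord F N ν M texpA p g k Z V = 0 := by
  unfold pieceOfRecord
  refine Finset.sum_eq_zero fun s hs => ?_
  exfalso
  rw [Finset.mem_filter] at hs
  apply hZ
  rw [← hs.2, compl_compl]
  rcases Nat.eq_zero_or_pos k with hk | hk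
  · subst hk
    rw [s.Λ_off 0 (by omega)]
    exact empty_mem_unionsOfCubes _ _
  · exact s.chain.memΛ k hk le_rfl

open Classical in
/-- **★★ THE LAST-REGION COUNT AT THE RECORD's CLASS `𝐃_k`** ((U2) in the (0.2) currency, PROVED): for `x ≥ 0` and any `a`,
`Σ_Z [Zᶜ ∈ 𝐃_k] · e^a · x^{#𝐃_k-cubes ⊄ Zᶜ} ≤ exp(a + x·|I_k|)`, `I_k` = the index family of the `M R_k`-cube partition defining `𝐃_k` of record (`DOfRecord = unionsOfCubes`,
`mem_unionsOfCubes_iff`); the sum over `Z` is the sum over `S = Zᶜ ∈ 𝐃_k` (complementation is a bijection), then `classSum_pow_lf_le_exp`. [cite: Balaban1988Convergent, p.264 («sum of terms similar to (3.42) [6]»); Balaban1982Higgs2, (3.46) p.593 (bookkeeping: the count in [III]'s letters)] -/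
theorem sum_lastRegionMajorant_le_exp (ν : Stage7Numerics) (M : ℕ) (g : ℕ → ℝ) (K k : ℕ) {x : ℝ} (hx : 0 ≤ x) (a : ℝ) :
    ∑ Z : Set (Site (F.P K) 0),
        (if Zᶜ ∈ DOfRecord F ν M g K k then
          Real.exp a * x ^ Set.ncard {c | c ∈ cubeIndices (F.P K) (dCubeSide (F.P K).L M (RkOfRecord (F.P K).L ν.r (g k)) k) ∧
            ¬ cubeEnl (F.P K) (dCubeSide (F.P K).L M (RkOfRecord (F.P K).L ν.r (g k)) k) c 0 ⊆ Zᶜ}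
        else 0)
      ≤ Real.exp (a + x * (cubeIndices (F.P K) (dCubeSide (F.P K).L M (RkOfRecord (F.P K).L ν.r (g k)) k)).card) := by
  -- (i) complementation re-indexes the sum over last regions `Z` as a sum over small-field domains `S = Zᶜ`
  have hre : ∑ Z : Set (Site (F.P K) 0),
        (if Zᶜ ∈ DOfRecord F ν M g K k then
          Real.exp a * x ^ Set.ncard {c | c ∈ cubeIndices (F.P K) (dCubeSide (F.P K).L M (RkOfRecord (F.P K).L ν.r (g k)) k) ∧
            ¬ cubeEnl (F.P K) (dCubeSide (F.P K).L M (RkOfRecord (F.P K).L ν.r (g k)) k) c 0 ⊆ Zᶜ}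
        else 0)
      = ∑ S : Set (Site (F.P K) 0),
        (if S ∈ DOfRecord F ν M g K k then
          Real.exp a * x ^ Set.ncard {c | c ∈ cubeIndices (F.P K) (dCubeSide (F.P K).L M (RkOfRecord (F.P K).L ν.r (g k)) k) ∧
            ¬ cubeEnl (F.P K) (dCubeSide (F.P K).L M (RkOfRecord (F.P K).L ν.r (g k)) k) c 0 ⊆ S}
        else 0) :=
    Fintype.sum_equiv (Function.Involutive.toPerm compl compl_involutive) _ _ fun Z => rfl
  rw [hre, ← Finset.sum_filter, ← Finset.mul_sum, Real.exp_add]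
  refine mul_le_mul_of_nonneg_left ?_ (Real.exp_pos a).le
  refine classSum_pow_lf_le_exp _ _ _ (fun S hS => ?_) hx
  rw [Finset.mem_filter] at hS
  exact (mem_unionsOfCubes_iff _ _ S).1 hS.2

/-- **THE CUBE COUNT AGAINST THE SITE COUNT** (the numeric clause's geometry): for `k ≤ K`, the `𝐃_k`-cube family of record has at most `|T₁^{(k)}|` members —
`|I_k| = ⌈2L^{m+K}∕(L^k·M·R_k)⌉⁴ ≤ (2L^{m+K−k})⁴` (cubes of side `L^k M R_k ≥ L^k` fine sites when `M R_k ≥ 1`; none when `M R_k = 0`). [cite: Balaban1988Convergent, (2.1) p.254; Balaban1987RG1, (0.1) p.251 (bookkeeping)] -/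
theorem card_cubeIndices_dCubeSide_le_card_site (K M R k : ℕ) (hk : k ≤ K) :
    (cubeIndices (F.P K) (dCubeSide (F.P K).L M R k)).card ≤ Fintype.card (Site (F.P K) k) := by
  rw [Site.card_site, cubeIndices, Fintype.card_piFinset, Finset.prod_const, Finset.card_univ, Fintype.card_fin,
    Finset.card_image_of_injective _ Nat.cast_injective, Finset.card_range]
  apply Nat.pow_le_pow_left
  -- `⌈n₀ ∕ s⌉ ≤ n₀ ∕ L^k` with `n₀ = 2L^{m+K}`, `s = L^k·M·R`
  have hL : 1 ≤ F.L := by have := F.hL.2; omega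
  have hn0 : (F.P K).sitesPerDir 0 = 2 * F.L ^ (F.m + K) := by simp [Params.sitesPerDir]
  have hnk : (F.P K).sitesPerDir k = 2 * F.L ^ (F.m + K - k) := by simp [Params.sitesPerDir]
  have hsd : dCubeSide (F.P K).L M R k = F.L ^ k * (M * R) := by simp [dCubeSide, mul_assoc]
  rw [hn0, hnk, hsd]
  have hsplit : 2 * F.L ^ (F.m + K) = 2 * F.L ^ (F.m + K - k) * F.L ^ k := by
    rw [mul_assoc, ← pow_add, Nat.sub_add_cancel (by omega)]
  rcases Nat.eq_zero_or_pos (M * R) with hMR | hMR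
  · rw [hMR, mul_zero, Nat.div_zero]; exact Nat.zero_le _
  · have hs : 0 < F.L ^ k * (M * R) := Nat.mul_pos (pow_pos (by omega : 0 < F.L) k) hMR
    apply Nat.le_of_lt_succ
    rw [Nat.div_lt_iff_lt_mul hs]
    have h1 : 2 * F.L ^ (F.m + K) ≤ 2 * F.L ^ (F.m + K - k) * (F.L ^ k * (M * R)) := by
      calc 2 * F.L ^ (F.m + K) = 2 * F.L ^ (F.m + K - k) * F.L ^ k * 1 := by rw [hsplit, mul_one]
        _ ≤ 2 * F.L ^ (F.m + K - k) * F.L ^ k * (M * R) := Nat.mul_le_mul_left _ hMR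
        _ = 2 * F.L ^ (F.m + K - k) * (F.L ^ k * (M * R)) := by ring
    have h2 : (2 * F.L ^ (F.m + K - k)).succ * (F.L ^ k * (M * R))
        = 2 * F.L ^ (F.m + K - k) * (F.L ^ k * (M * R)) + F.L ^ k * (M * R) := by rw [Nat.succ_mul]
    rw [h2]
    omega

end LastRegion

/-! ## §3. AT K1⁷'s RECORD: the upper half of (0.1) from ONE displayed per-last-region estimate, the combinatorial leaf PROVED -/

section AtRecord

variable (F : T4Family) (N : ℕ) [NeZero N]
variable (θ : Stage13HParams F N) (P : B12.RunParams) (k : ℕ)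

open Classical in
/-- **(0.2) [IV] FOR THE DENSITY OF RECORD**: `ρ_k(V) = Σ_Z ρ_k(Z, V)` over the last large-field regions, the pieces being def-R's `pieceOfRecord` at the Stage-13 slots of record
(`densOfRecord₁₃ = densityOfRepr … (slotsOfRecord …)` by construction; `sum_pieceOfRecord`). [cite: Balaban1989LargeFieldI, (0.2) p.176; Balaban1988Convergent, (2.18) p.257 (bookkeeping)] -/
theorem densOfRecord₁₃_eq_sum_pieceOfRecord (V : GaugeField (F.P P.K) k (SU N)) :
    densOfRecord₁₃ F N θ.toStage13Params P k V =
      ∑ Z : Set (Site (F.P P.K) 0), pieceOfRecord F N θ.ν θ.τ9.M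
        (slotsOfRecord F N θ.ν θ.τ9 (EOfRecord₁₃ F N θ.toStage13Params) (wOfRecord₉ F N θ.toStage9Params) θ.ppSel)
        P (gOfRecord₁₃ F N θ.toStage13Params P) k Z V :=
  (sum_pieceOfRecord F N θ.ν θ.τ9.M _ P _ k V).symm

open Classical in
/-- **UPPER HALF OF (0.1) AT THE RECORD FROM PER-LAST-REGION MAJORANTS** ((U1_Z) + (U2_Z), the (0.2)-currency twin of adv3's (U1) + (U2)): if every piece `ρ_k(Z, ·)` is bounded by
`majorZ Z` uniformly in `V` and `Σ_Z majorZ Z ≤ exp(E₊|T₁^{(k)}|)`, then `ρ_k(V) ≤ exp(E₊|T₁^{(k)}|)`. [cite: Balaban1988Convergent, Cor. 3 (2.50) p.264; Balaban1989LargeFieldI, (0.2) p.176 (bookkeeping)] -/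
theorem densOfRecord₁₃_le_of_U1Z_U2Z (majorZ : Set (Site (F.P P.K) 0) → ℝ) (Ep : ℝ)
    (hU1Z : ∀ Z V, pieceOfRecord F N θ.ν θ.τ9.M
        (slotsOfRecord F N θ.ν θ.τ9 (EOfRecord₁₃ F N θ.toStage13Params) (wOfRecord₉ F N θ.toStage9Params) θ.ppSel)
        P (gOfRecord₁₃ F N θ.toStage13Params P) k Z V ≤ majorZ Z)
    (hU2Z : ∑ Z, majorZ Z ≤ Real.exp (Ep * (Fintype.card (Site (F.P P.K) k) : ℝ))) :
    ∀ V : GaugeField (F.P P.K) k (SU N), densOfRecord₁₃ F N θ.toStage13Params P k V ≤ Real.exp (Ep * (Fintype.card (Site (F.P P.K) k) : ℝ)) := by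
  intro V
  rw [densOfRecord₁₃_eq_sum_pieceOfRecord]
  exact (Finset.sum_le_sum fun Z _ => hU1Z Z V).trans hU2Z

open Classical in
/-- **★★★ THE UPPER HALF OF (0.1) AT K1⁷'s RECORD WITH THE COMBINATORIAL LEAF PROVED**: from the ONE displayed estimate (U1_Z) «every piece of `ρ_k` of record with last region `Z`,
`Zᶜ ∈ 𝐃_k`, obeys `ρ_k(Z, V) ≤ e^a · x^{#𝐃_k-cubes meeting Z}` with `0 ≤ x`» ([IV] (1.1)∕[V] (1.89)-type small factor per large-field cube of the last region — NOT proved here)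
and the NUMERIC clause `a + x·|I_k| ≤ E₊·|T₁^{(k)}|`, conclude `ρ_k(V) ≤ exp(E₊|T₁^{(k)}|)` at every configuration: the pieces with `Zᶜ ∉ 𝐃_k` vanish
(`pieceOfRecord_eq_zero_of_compl_not_mem`) and the count is `sum_lastRegionMajorant_le_exp`. [cite: Balaban1988Convergent, Cor. 3 (2.50) and the sentence before it, p.264; Balaban1989LargeFieldI, (0.2) p.176] -/
theorem densOfRecord₁₃_le_of_pieceBound {x : ℝ} (hx : 0 ≤ x) (a Ep : ℝ)
    (hU1Z : ∀ Z : Set (Site (F.P P.K) 0), Zᶜ ∈ DOfRecord F θ.ν θ.τ9.M (gOfRecord₁₃ F N θ.toStage13Params P) P.K k →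
      ∀ V : GaugeField (F.P P.K) k (SU N), pieceOfRecord F N θ.ν θ.τ9.M
        (slotsOfRecord F N θ.ν θ.τ9 (EOfRecord₁₃ F N θ.toStage13Params) (wOfRecord₉ F N θ.toStage9Params) θ.ppSel)
        P (gOfRecord₁₃ F N θ.toStage13Params P) k Z V ≤
        Real.exp a * x ^ Set.ncard {c | c ∈ cubeIndices (F.P P.K) (dCubeSide (F.P P.K).L θ.τ9.M
            (RkOfRecord (F.P P.K).L θ.ν.r (gOfRecord₁₃ F N θ.toStage13Params P k)) k) ∧
          ¬ cubeEnl (F.P P.K) (dCubeSide (F.P P.K).L θ.τ9.M (RkOfRecord (F.P P.K).L θ.ν.r (gOfRecord₁₃ F N θ.toStage13Params P k)) k) c 0 ⊆ Zᶜ})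
    (hnum : a + x * (cubeIndices (F.P P.K) (dCubeSide (F.P P.K).L θ.τ9.M
        (RkOfRecord (F.P P.K).L θ.ν.r (gOfRecord₁₃ F N θ.toStage13Params P k)) k)).card ≤ Ep * (Fintype.card (Site (F.P P.K) k) : ℝ)) :
    ∀ V : GaugeField (F.P P.K) k (SU N), densOfRecord₁₃ F N θ.toStage13Params P k V ≤ Real.exp (Ep * (Fintype.card (Site (F.P P.K) k) : ℝ)) := by
  refine densOfRecord₁₃_le_of_U1Z_U2Z F N θ P k
    (fun Z => if Zᶜ ∈ DOfRecord F θ.ν θ.τ9.M (gOfRecord₁₃ F N θ.toStage13Params P) P.K k then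
      Real.exp a * x ^ Set.ncard {c | c ∈ cubeIndices (F.P P.K) (dCubeSide (F.P P.K).L θ.τ9.M
          (RkOfRecord (F.P P.K).L θ.ν.r (gOfRecord₁₃ F N θ.toStage13Params P k)) k) ∧
        ¬ cubeEnl (F.P P.K) (dCubeSide (F.P P.K).L θ.τ9.M (RkOfRecord (F.P P.K).L θ.ν.r (gOfRecord₁₃ F N θ.toStage13Params P k)) k) c 0 ⊆ Zᶜ}
      else 0) Ep (fun Z V => ?_) ?_
  · by_cases hZ : Zᶜ ∈ DOfRecord F θ.ν θ.τ9.M (gOfRecord₁₃ F N θ.toStage13Params P) P.K k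
    · rw [if_pos hZ]; exact hU1Z Z hZ V
    · rw [if_neg hZ, pieceOfRecord_eq_zero_of_compl_not_mem F N θ.ν θ.τ9.M _ P _ k Z hZ V]
  · exact (sum_lastRegionMajorant_le_exp F θ.ν θ.τ9.M (gOfRecord₁₃ F N θ.toStage13Params P) P.K k hx a).trans
      (Real.exp_le_exp.mpr hnum)

open Classical in
/-- **THE SAME WITH THE NUMERIC CLAUSE IN SITE UNITS** (`card_cubeIndices_dCubeSide_le_card_site`): for `k ≤ K`, `0 ≤ x`, a per-last-region bound `ρ_k(Z, V) ≤ e^{a₀|T₁^{(k)}|} · x^{#𝐃_k-cubes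
meeting Z}` with `a₀ + x ≤ E₊` gives `ρ_k(V) ≤ exp(E₊|T₁^{(k)}|)` — the small factor `x ≤ 1` costs at most ONE unit of `E₊`. [cite: Balaban1988Convergent, Cor. 3 (2.50) p.264; Balaban1989LargeFieldI, (0.2) p.176 (bookkeeping)] -/
theorem densOfRecord₁₃_le_of_pieceBound_siteUnits (hk : k ≤ P.K) {x : ℝ} (hx : 0 ≤ x) (a₀ Ep : ℝ) (ha : a₀ + x ≤ Ep)
    (hU1Z : ∀ Z : Set (Site (F.P P.K) 0), Zᶜ ∈ DOfRecord F θ.ν θ.τ9.M (gOfRecord₁₃ F N θ.toStage13Params P) P.K k →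
      ∀ V : GaugeField (F.P P.K) k (SU N), pieceOfRecord F N θ.ν θ.τ9.M
        (slotsOfRecord F N θ.ν θ.τ9 (EOfRecord₁₃ F N θ.toStage13Params) (wOfRecord₉ F N θ.toStage9Params) θ.ppSel)
        P (gOfRecord₁₃ F N θ.toStage13Params P) k Z V ≤
        Real.exp (a₀ * (Fintype.card (Site (F.P P.K) k) : ℝ)) * x ^ Set.ncard {c | c ∈ cubeIndices (F.P P.K) (dCubeSide (F.P P.K).L θ.τ9.M
            (RkOfRecord (F.P P.K).L θ.ν.r (gOfRecord₁₃ F N θ.toStage13Params P k)) k) ∧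
          ¬ cubeEnl (F.P P.K) (dCubeSide (F.P P.K).L θ.τ9.M (RkOfRecord (F.P P.K).L θ.ν.r (gOfRecord₁₃ F N θ.toStage13Params P k)) k) c 0 ⊆ Zᶜ}) :
    ∀ V : GaugeField (F.P P.K) k (SU N), densOfRecord₁₃ F N θ.toStage13Params P k V ≤ Real.exp (Ep * (Fintype.card (Site (F.P P.K) k) : ℝ)) := by
  refine densOfRecord₁₃_le_of_pieceBound F N θ P k hx (a₀ * (Fintype.card (Site (F.P P.K) k) : ℝ)) Ep hU1Z ?_
  have hI : ((cubeIndices (F.P P.K) (dCubeSide (F.P P.K).L θ.τ9.M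
        (RkOfRecord (F.P P.K).L θ.ν.r (gOfRecord₁₃ F N θ.toStage13Params P k)) k)).card : ℝ)
      ≤ (Fintype.card (Site (F.P P.K) k) : ℝ) := by
    exact_mod_cast card_cubeIndices_dCubeSide_le_card_site F P.K θ.τ9.M _ k hk
  have hT : (0 : ℝ) ≤ (Fintype.card (Site (F.P P.K) k) : ℝ) := Nat.cast_nonneg _
  nlinarith [mul_le_mul_of_nonneg_left hI hx, mul_le_mul_of_nonneg_right ha hT]


end AtRecord


end Summit.QuantumFields.YangMills.BalabanUVNodes.N13Cor3LastRegionCountAtRecord13CoPH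

end
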